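import Literature.AnabelianGeometry.AbsoluteAnabelian.AbsAnabFundamentalGroups
import Literature.AnabelianGeometry.AbsoluteAnabelian.AbsTopIII.CurveModel
import HarnessLib

/-!
# [AbsTopIII] Cor. 1.10 (iii) WITH ITS PRINTED FUNCTORIALITY, Galois side — PROFINITE version

S. Mochizuki, *Topics in Absolute Anabelian Geometry III: Global Reconstruction Algorithms*, §1, author's
manuscript (kurims render, lit key `paper:url-5493eb38cbb7`; every locator below was read on that render):

* Cor. 1.10 p. 41 l. 28–38: «(Reconstruction of the Function Field for MLF's) Let `X` be a hyperbolic orbicurve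
  over an MLF `k`; `k̄` an algebraic closure of `k` […] `1 → Δ_X → Π_X → G_k → 1` — where
  `Π_X := π₁(X) → G_k := Gal(k̄/k)` denotes the natural surjection of étale fundamental groups […] — the resulting
  extension of profinite groups.»
* Cor. 1.10 (iii) p. 43 l. 27–30: «Suppose further that `X` is of strictly Belyi type [so that we are in the
  situation of Theorem 1.9]. Then there exists a functorial "group-theoretic" algorithm for reconstructing the
  function field `K_X` of `X` from the profinite group `Π_X` [cf. Remark 1.9.2], as follows:» — steps (e)–(h);
  (h) p. 44 l. 8–12 and l. 18–24: «One constructs the additive structure on [the image — cf. (d) — of]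
  `k^× ∪ {0}` as the unique continuous extension of the additive structure on `(k^× ∩ k̄^×_NF) ∪ {0}`
  constructed in Theorem 1.9, (e). […] compatible […] with the additive structures on the various
  `(k′)^× ∪ {0}`, for `k′ ⊆ k̄` a finite extension of `k`»; p. 44 l. 33–34: «Here, the asserted "functoriality"
  is with respect to arbitrary open injective homomorphisms of profinite groups [i.e., of "`Π_X`"] — cf. Remark
  1.10.1 below.»
* Rmk. 1.9.2 p. 38 l. 31–35: «When `k` is an MLF or NF […], the "extension of profinite groups
  `1 → Δ_X → Π_X → G_k → 1`" that appears in the input data for the algorithm of Theorem 1.9 may be replaced by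
  the single profinite group `Π_X` [cf. [Mzk20], Theorem 2.6, (v), (vi)].»
* [AbsTopII] Def. 3.5 (kurims url-585b8d0ad0d9, p. 71): «We shall say that `X` is of strictly Belyi type if it is
  defined over a number field and isogenous to a hyperbolic curve of genus zero» (the field `IsStrictlyBelyiType`
  of the tree's `CurveModel`).

## What is typed, and why in this shape

THE GALOIS SIDE OF THE FUNCTORIALITY OF Cor. 1.10 (iii), PROFINITE version.  Read the functorial algorithm
`Π_X ↦ k̄(Π_X) = ⋃_{k′} (k′)^× ∪ {0}` of (iii)(h) (a topological field on which `Π_X` acts through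
`Π_X ↠ G_k`) on a topological AUTOMORPHISM `α` of the profinite group `Π_X`: functoriality transports `k̄(Π_X)` to
itself `Π_X`-semilinearly along `α`; comparing with the tautological `G_k`-equivariant identification
`k̄(Π_X) = k̄` (the Kummer map of (ii)(d)) and with `k̄ ≅ ℚ̄_p` (every algebraic closure of `k` is one of `ℚ_p`),
`α` induces a continuous field automorphism `τ` of `ℚ̄_p` — an element of `G_{ℚ_p} = Gal(ℚ̄_p/ℚ_p)` — such that
the automorphism of `G_k ↪ G_{ℚ_p}` induced by `α` is the restriction of `Inn(τ)`:

  (HGAL)  `∀ α ∈ Aut_top(Π_X) ∃ τ ∈ G_{ℚ_p} ∀ x ∈ Π_X, j(aug(α x)) = τ · j(aug(x)) · τ⁻¹`,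

`j : G_k ↪ G_{ℚ_p}` the restriction map attached to `ℚ_p ⊆ k` (well defined up to `G_{ℚ_p}`-conjugacy, under
which (HGAL) is invariant; the tree's canonical choice is
`Literature.NumberTheory.GaloisRepresentations.absGaloisRestrict ℚ_[p] k`).  This file is the PROFINITE twin of
`Cor110Natural.lean` (abc-iut-f-052: `TemperedAutOverGQp` / `Cor_1_10_iii_natural`, the TEMPERED version over
the [EtTh] §1 setting, consumed at the BAD places of an initial Θ-datum).  The profinite version is print's
input at the GOOD nonarchimedean places: [IUTchI] Def. 3.1 (f) (kurims url-690e7b3c6199 p. 63) «if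
`v ∈ V̲^good`, then we shall write `Π_v̲ := Π_{X̲→_v̲}`» (the PROFINITE étale fundamental group), and Example 3.3
(iii)(e) p. 79 l. 52–63 «by applying the algorithmically constructed field structure on the image of the Kummer
map of [AbsTopIII], Proposition 3.2, (iii) […] one may construct the element "`p_v`" of `𝒪^▷_{K_v}`
category-theoretically from `F̲_v` […] [Here, we recall that the curve `X_F` is "of strictly Belyi type" — cf.
[AbsTopIII], Remark 2.8.3.] In particular, (e) one may reconstruct the split Frobenioids `F⊢_v`, `F^Θ_v`
category-theoretically from `F̲_v`».  The abc-iut cone consumer is abc-iut-L5's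
`Literature.IUT.HodgeTheaters.InitialThetaData.splitFromF_goodLocalFrobenioidOfEmb_of_conj_autCongr` (binder
`hconj`, GAP-LEDGER row G-L5t16g8-1); the tempered fact cannot serve there — `Π_v̲` is compact while every
finite-index subgroup of a tempered `Π^tp_X` is not
(`Literature.IUT.HodgeTheaters.InitialThetaData.isEmpty_continuousMulEquiv_piLoc_thetaSetting`).

THE FROZEN ROW UNDER-READS PRINT.  `CurveModel.Cor_1_10_iii` (FACT-LIST F-0396, `Reconstruction.lean`) types
Cor. 1.10 (iii) as bare EXISTENCE of an algorithm record whose functoriality fields transport the two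
reconstructed fields `k ⊆ K_X` along isomorphisms of extensions, with NO clause tying the transported field
isomorphism to the Galois action of a GIVEN `α` (limitation recorded in `Cor110Natural.lean` and in GAP-LEDGER
G-w4d042-1 / G-w5d145-2 / G-L5t16g8-1); it cannot supply (HGAL).  Hence this SEPARATE predicate, as for the
tempered twin; the frozen declarations are not edited.

SHAPE.  Two declarations, statement-only (no instance / notation / axiom; nothing of [AbsTopIII] is asserted):
* `ProfiniteAutOverGQp E B` — (HGAL) as a PREDICATE on an abstract extension `E = (1 → Δ → Π → G → 1)`
  (abc-iut-L4-t1's `FundamentalExtension`) WITH MLF base data `B` (abc-iut-L4-t4's `MLFBase`: a prime `p`, a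
  finite extension `K` of `ℚ_p`, `galIso : G ≃ₜ* Gal(K̄/K)`), `τ` ranging over Mathlib's
  `Field.absoluteGaloisGroup ℚ_[p]` (definitionally the tree's `SemiGraphs.GQp p`) and `j` the canonical
  restriction `absGaloisRestrict ℚ_[B.p] B.K`.  Typing policy θ of plan/L4/ASSIGNMENTS.md §2 (cf.
  `AbsAnabFundamentalGroups.lean`): a predicate stating the printed CONCLUSION on abstract data, to be bound BY
  NAME at a genuine packaging `(Π_X ↠ G_k, k)`; it asserts nothing by itself, and its universal closure over
  all `(E, B)` is NOT claimed (abstract extensions need not come from curves).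
* `CurveModel.Cor_1_10_iii_galois M` — the closed printed-strength form RELATIVE TO A MODEL `M : CurveModel`
  (the carrier of F-0396): for every curve `X` of the model that is of strictly Belyi type, every `ℚ_p`-algebra
  structure of finite degree on its base field `k = M.base X` (making `k` an MLF) and the model's own
  identification `galIso : G ≅ Gal(k̄/k)`, (HGAL) holds for `M.ext X`.  NAMED FACT relative to `M`.
-- TODO(general form): Cor. 1.10 (iii) reconstructs the pair of fields `k̄ ⊆ K_X·k̄` with its `Π_X`-action,
-- functorially in arbitrary OPEN INJECTIVE homomorphisms `Π_X → Π_Y` (Rmk. 1.10.1 (i)); typed here is only the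
-- consequence for AUTOMORPHISMS on the Galois side (the clause the abc-iut cone consumes).

HONEST FRAMING: [AbsTopIII] (PRIMS 2015) is refereed and not disputed; (HGAL) at a genuine `Π_X` rests in print
on Mochizuki's absolute anabelian results for curves of strictly Belyi type over MLF's (Thm. 1.9, [AbsTopII]
Cor. 3.7), none of which is in the tree (plan/FOUNDATIONS.md row 12); a by-name binder of this predicate is an
ASSUMPTION LABEL on OUR typed statement; typed ≠ proved; no side is taken on [IUTchIII] Cor. 3.12; nothing
here bears on the truth of abc.
-/

noncomputable section

namespace Literature.AnabelianGeometry.AbsoluteAnabelian.AbsTopIII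

open Field Literature.NumberTheory.GaloisRepresentations

universe u

/-- **(HGAL), profinite version, for an extension `E = (1 → Δ → Π → G → 1)` with MLF base data
`B = (p, K, galIso : G ≃ₜ* Gal(K̄/K))`** — «every topological automorphism `α` of the profinite group `Π` lies
over an inner automorphism of `G_{ℚ_p}`»: for every `α : Π ≃ₜ* Π` there is `τ ∈ G_{ℚ_p} = Gal(ℚ̄_p/ℚ_p)` with
`j(aug(α x)) = τ · j(aug(x)) · τ⁻¹` for all `x ∈ Π`, where `j : Gal(K̄/K) → Gal(ℚ̄_p/ℚ_p)` is the restriction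
map attached to `ℚ_p ⊆ K` (the tree's `absGaloisRestrict ℚ_[p] K`, canonical up to `G_{ℚ_p}`-conjugacy — under
which the statement is invariant).  This is the Galois-side content, on automorphisms, of the functoriality
«with respect to arbitrary open injective homomorphisms of profinite groups [i.e., of "`Π_X`"]» (p. 44
l. 33–34) of the algorithm `Π_X ↦ (k̄ ⊇ k, K_X)` of Cor. 1.10 (iii) (p. 43 l. 27–30, (h) p. 44 l. 8–24), at
`E = (Π_X ↠ G_k)` for `X` a hyperbolic orbicurve of strictly Belyi type over the MLF `k = K`.  A PREDICATE on
abstract data (typing policy θ: the printed conclusion, bound BY NAME at genuine packagings); nothing is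
asserted, and no universal closure over abstract `(E, B)` is claimed.  Profinite twin of `TemperedAutOverGQp`.
[cite: MochizukiAbsTopIII2015, Cor 1.10 (iii) p.43] -/
def ProfiniteAutOverGQp (E : FundamentalExtension.{u}) (B : E.MLFBase) : Prop :=
  ∀ α : E.arith ≃ₜ* E.arith, ∃ τ : absoluteGaloisGroup ℚ_[B.p], ∀ x : E.arith,
    absGaloisRestrict ℚ_[B.p] B.K (B.galIso (E.aug (α x))) =
      τ * absGaloisRestrict ℚ_[B.p] B.K (B.galIso (E.aug x)) * τ⁻¹

namespace CurveModel

/-- **[AbsTopIII] Cor. 1.10 (iii) with its printed functoriality (p. 43 l. 27–30, p. 44 l. 33–34), Galois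
side, PROFINITE version, relative to a model `M`** — the printed-strength Galois-side companion of FACT-LIST row
F-0396 `CurveModel.Cor_1_10_iii` (bare existence of the reconstruction algorithm): for every curve `X` of the
model «of strictly Belyi type» ([AbsTopII] Def. 3.5) whose base field `k = M.base X` is an MLF — rendered as: for
every prime `p` and every `ℚ_p`-algebra structure of finite degree on `k` ([AbsTopI] §0 «a finite field
extension of `ℚ_p`») — and for the model's own identification `galIso : G ≅ Gal(k̄/k)` («`G_k := Gal(k̄/k)`»,
p. 41 l. 36), every topological automorphism of the profinite group `Π_X` lies over `Inn(τ)|_{G_k}` for some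
`τ ∈ G_{ℚ_p}` ((HGAL), `ProfiniteAutOverGQp (M.ext X) ⟨p, k, galIso⟩`): the reconstructed topological field
`k̄ = ⋃ (k′)^× ∪ {0}` of (iii)(h) is FUNCTORIAL in `Π_X` (input = the single profinite group `Π_X`, Rmk. 1.9.2),
so an automorphism of `Π_X` induces a continuous automorphism of `k̄ ≅ ℚ̄_p` over `ℚ_p`, i.e. an element of
`G_{ℚ_p}`, compatibly with `Π_X ↠ G_k ↪ G_{ℚ_p}`.  NAMED FACT relative to `M` (the intended model is the étale
`π₁`, plan/FOUNDATIONS.md row 12; nothing asserts that a model exists).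
-- TODO(general form): the full output `(k̄ ⊆ K_X·k̄)` with its `Π_X`-action, functorial in open injective
-- homomorphisms (Rmk. 1.10.1 (i)); only the automorphism/Galois-side consequence is typed.
[cite: MochizukiAbsTopIII2015, Cor 1.10 (iii) p.43] -/
def Cor_1_10_iii_galois (M : CurveModel.{u}) : Prop :=
  ∀ (X : M.Curve) (p : ℕ) [Fact p.Prime] [Algebra ℚ_[p] (M.base X)] [FiniteDimensional ℚ_[p] (M.base X)],
    M.IsStrictlyBelyiType X →
      ∀ gi : (M.ext X).gal ≃ₜ* absoluteGaloisGroup (M.base X),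
        (∀ g, gi g = (M.galIso X).hom.hom g) →
          ProfiniteAutOverGQp (M.ext X) { p := p, K := M.base X, galIso := gi }

end CurveModel

end Literature.AnabelianGeometry.AbsoluteAnabelian.AbsTopIII

end
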